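import Mathlib

/-!
# Isogenies of lattices induce isomorphisms on `Hom(−, V)` for every `ℚ`-vector space `V`

Kernel support for the blind cell pub-hodge-repro2 (seat p2), T5-ID §ID-2(b): «an isogeny induces an
isomorphism on `H^1(·, ℚ)`» (Lemma B7.1's argument).  Model: `H_1(A, ℤ) = Λ` is a lattice; an isogeny
`A → A'` induces an injective `ℤ`-linear map `f : Λ → Λ'` whose image has finite index (the degree of the
isogeny); `H^1(A, V) = Hom_ℤ(Λ, V)` for `V = ℚ`, `ℂ`, or any `ℚ`-vector space.  The pull-back `φ ↦ φ ∘ f`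
is then a bijection `Hom_ℤ(Λ', V) ≃ Hom_ℤ(Λ, V)`, linear for every scalar ring `S` acting on `V`, and
equivariant for compatible endomorphisms of `Λ`, `Λ'` (the `F`-action of a CM abelian variety), so it maps
eigenspaces onto eigenspaces.  Rational homology: `ℚ ⊗_ℤ Λ → ℚ ⊗_ℤ Λ'` is an isomorphism as well.

No geometry is formalised: the abelian varieties, the isogeny itself and the identification
`H_1(A, ℤ) = Λ` stay prose (the annex row records this).
-/

namespace Summit.Ventures.HodgeRepro2.IsogenyRational

variable {Λ Λ' Λ'' : Type*} [AddCommGroup Λ] [AddCommGroup Λ'] [AddCommGroup Λ'']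

/-- `f : Λ → Λ'` is an *isogeny of lattices*: it is injective and some positive multiple of every element
of `Λ'` lies in its image (this holds as soon as the image has finite index, `of_finiteIndex` below). -/
def IsLatticeIsogeny (f : Λ →ₗ[ℤ] Λ') : Prop :=
  Function.Injective f ∧ ∃ n : ℕ, 0 < n ∧ ∀ x : Λ', n • x ∈ LinearMap.range f

/-- An isogeny has finite kernel, i.e. is injective on the lattices. -/
theorem IsLatticeIsogeny.injective {f : Λ →ₗ[ℤ] Λ'} (hf : IsLatticeIsogeny f) :
    Function.Injective f := hf.1

/-- For an isogeny, a positive multiple of every element of the target lies in the image. -/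
theorem IsLatticeIsogeny.exists_nsmul_mem {f : Λ →ₗ[ℤ] Λ'} (hf : IsLatticeIsogeny f) :
    ∃ n : ℕ, 0 < n ∧ ∀ x : Λ', n • x ∈ LinearMap.range f := hf.2

/-- An injective lattice map whose image has finite index is an isogeny of lattices. -/
theorem IsLatticeIsogeny.of_finiteIndex (f : Λ →ₗ[ℤ] Λ') (hinj : Function.Injective f)
    [hfin : (LinearMap.range f).toAddSubgroup.FiniteIndex] : IsLatticeIsogeny f :=
  ⟨hinj, (LinearMap.range f).toAddSubgroup.index, Nat.pos_of_ne_zero hfin.index_ne_zero,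
    fun x => AddSubgroup.nsmul_index_mem (LinearMap.range f).toAddSubgroup x⟩

/-- An injective lattice map with finite cokernel is an isogeny of lattices. -/
theorem IsLatticeIsogeny.of_finite_quotient (f : Λ →ₗ[ℤ] Λ') (hinj : Function.Injective f)
    [Finite (Λ' ⧸ (LinearMap.range f).toAddSubgroup)] : IsLatticeIsogeny f :=
  haveI : (LinearMap.range f).toAddSubgroup.FiniteIndex := AddSubgroup.finiteIndex_of_finite_quotient
  IsLatticeIsogeny.of_finiteIndex f hinj

/-- A bijective lattice map (an isomorphism) is an isogeny. -/
theorem IsLatticeIsogeny.of_bijective (f : Λ →ₗ[ℤ] Λ') (hf : Function.Bijective f) :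
    IsLatticeIsogeny f :=
  ⟨hf.1, 1, one_pos, fun x => by
    obtain ⟨y, hy⟩ := hf.2 x
    exact ⟨y, by rw [one_smul, hy]⟩⟩

/-- The composition of two isogenies of lattices is an isogeny (degrees multiply). -/
theorem IsLatticeIsogeny.comp {f : Λ →ₗ[ℤ] Λ'} {g : Λ' →ₗ[ℤ] Λ''} (hf : IsLatticeIsogeny f)
    (hg : IsLatticeIsogeny g) : IsLatticeIsogeny (g.comp f) := by
  refine ⟨hg.injective.comp hf.injective, ?_⟩
  obtain ⟨n, hn, hnmem⟩ := hf.exists_nsmul_mem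
  obtain ⟨m, hm, hmmem⟩ := hg.exists_nsmul_mem
  refine ⟨n * m, Nat.mul_pos hn hm, fun x => ?_⟩
  obtain ⟨y, hy⟩ := LinearMap.mem_range.mp (hmmem x)
  obtain ⟨z, hz⟩ := LinearMap.mem_range.mp (hnmem y)
  refine ⟨z, ?_⟩
  rw [LinearMap.comp_apply, hz, map_nsmul, hy, mul_smul]

section Pullback

variable {V : Type*} [AddCommGroup V]
variable (S : Type*) [Semiring S] [Module S V] [SMulCommClass ℤ S V]

/-- The pull-back `φ ↦ φ ∘ f` on `V`-valued homomorphisms (`H^1(A', V) → H^1(A, V)`), `S`-linear for every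
scalar ring `S` acting on `V` (`S = ℚ` for `V = ℚ`; `S = ℂ` for `V = ℂ`). -/
def pullback (f : Λ →ₗ[ℤ] Λ') : (Λ' →ₗ[ℤ] V) →ₗ[S] (Λ →ₗ[ℤ] V) :=
  LinearMap.lcomp S V f

/-- The pull-back of `φ` along `f` is the composite `φ ∘ f`. -/
@[simp] theorem pullback_apply (f : Λ →ₗ[ℤ] Λ') (φ : Λ' →ₗ[ℤ] V) :
    pullback (V := V) S f φ = φ.comp f := rfl

/-- Evaluation of the pull-back: `(φ ∘ f) x = φ (f x)`. -/
theorem pullback_apply_apply (f : Λ →ₗ[ℤ] Λ') (φ : Λ' →ₗ[ℤ] V) (x : Λ) :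
    pullback (V := V) S f φ x = φ (f x) := rfl

/-- The endomorphism `φ ↦ φ ∘ a` of `Hom_ℤ(Λ, V)` induced by an endomorphism `a` of the lattice `Λ`
(the action of `End(A)` — e.g. of the CM field — on `H^1(A, V)`). -/
def actOn (a : Λ →ₗ[ℤ] Λ) : (Λ →ₗ[ℤ] V) →ₗ[S] (Λ →ₗ[ℤ] V) :=
  LinearMap.lcomp S V a

/-- The induced endomorphism is pre-composition with `a`. -/
@[simp] theorem actOn_apply (a : Λ →ₗ[ℤ] Λ) (φ : Λ →ₗ[ℤ] V) : actOn (V := V) S a φ = φ.comp a := rfl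

/-- Equivariance of the pull-back: if `f ∘ a = a' ∘ f` then `(φ ∘ a') ∘ f = (φ ∘ f) ∘ a`. -/
theorem pullback_actOn {f : Λ →ₗ[ℤ] Λ'} {a : Λ →ₗ[ℤ] Λ} {a' : Λ' →ₗ[ℤ] Λ'}
    (hcomm : f.comp a = a'.comp f) (φ : Λ' →ₗ[ℤ] V) :
    pullback (V := V) S f (actOn S a' φ) = actOn S a (pullback (V := V) S f φ) := by
  simp only [pullback_apply, actOn_apply, LinearMap.comp_assoc, hcomm]

end Pullback

section RationalTarget

variable {V : Type*} [AddCommGroup V] [Module ℚ V]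

/-- A `ℚ`-vector space has no `ℤ`-torsion: `n • v = 0` with `n > 0` forces `v = 0`. -/
theorem nsmul_eq_zero_iff_of_pos {n : ℕ} (hn : 0 < n) {v : V} : n • v = 0 ↔ v = 0 := by
  constructor
  · intro h
    have h' : ((n : ℚ)⁻¹ * (n : ℚ)) • v = 0 := by
      rw [mul_smul, Nat.cast_smul_eq_nsmul, h, smul_zero]
    rwa [inv_mul_cancel₀ (by exact_mod_cast hn.ne'), one_smul] at h'
  · rintro rfl
    exact smul_zero n

/-- A `ℚ`-vector space is divisible: every `v` is `n • w` for `w = (1/n) • v`. -/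
theorem exists_nsmul_eq_of_pos {n : ℕ} (hn : 0 < n) (v : V) : ∃ w : V, n • w = v :=
  ⟨(n : ℚ)⁻¹ • v, by
    rw [← Nat.cast_smul_eq_nsmul ℚ, smul_smul, mul_inv_cancel₀ (by exact_mod_cast hn.ne'), one_smul]⟩

variable (S : Type*) [Semiring S] [Module S V] [SMulCommClass ℤ S V]

/-- Injectivity of the pull-back along an isogeny: a homomorphism `Λ' → V` vanishing on the image of `f`
vanishes, because `n • x` lies in the image and `V` has no torsion. -/
theorem pullback_injective {f : Λ →ₗ[ℤ] Λ'} (hf : IsLatticeIsogeny f) :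
    Function.Injective (pullback (V := V) S f) := by
  intro φ ψ h
  obtain ⟨n, hn, hmem⟩ := hf.exists_nsmul_mem
  ext x
  obtain ⟨y, hy⟩ := LinearMap.mem_range.mp (hmem x)
  have h1 : φ (f y) = ψ (f y) := by
    have := congrArg (fun χ : Λ →ₗ[ℤ] V => χ y) h
    simpa using this
  rw [hy, map_nsmul, map_nsmul] at h1
  have h2 : n • (φ x - ψ x) = 0 := by rw [smul_sub, h1, sub_self]
  exact sub_eq_zero.mp ((nsmul_eq_zero_iff_of_pos hn).mp h2)

/-- Surjectivity of the pull-back along an isogeny: given `ψ : Λ → V`, the homomorphism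
`φ (x) := (1/n) • ψ (y)` with `f y = n • x` is well defined (`f` injective) and satisfies `φ ∘ f = ψ`. -/
theorem pullback_surjective {f : Λ →ₗ[ℤ] Λ'} (hf : IsLatticeIsogeny f) :
    Function.Surjective (pullback (V := V) S f) := by
  obtain ⟨n, hn, hmem⟩ := hf.exists_nsmul_mem
  have hmem' : ∀ x : Λ', ∃ y : Λ, f y = n • x := fun x => LinearMap.mem_range.mp (hmem x)
  choose y hy using hmem'
  intro ψ
  have hadd : ∀ a b : Λ', y (a + b) = y a + y b := by
    intro a b
    apply hf.injective
    rw [map_add, hy, hy, hy, smul_add]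
  have hzero : y 0 = 0 := by
    apply hf.injective
    rw [hy, smul_zero, map_zero]
  let φ₀ : Λ' →+ V :=
    { toFun := fun x => (n : ℚ)⁻¹ • ψ (y x)
      map_zero' := by simp [hzero]
      map_add' := fun a b => by simp [hadd, smul_add] }
  refine ⟨φ₀.toIntLinearMap, ?_⟩
  ext z
  have hz : y (f z) = n • z := by
    apply hf.injective
    rw [hy, map_nsmul]
  simp only [pullback_apply_apply, AddMonoidHom.coe_toIntLinearMap, AddMonoidHom.coe_mk,
    ZeroHom.coe_mk, φ₀, hz, map_nsmul]
  rw [← Nat.cast_smul_eq_nsmul ℚ n (ψ z), smul_smul,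
    inv_mul_cancel₀ (by exact_mod_cast hn.ne'), one_smul]

/-- The pull-back along an isogeny of lattices is bijective on `V`-valued homomorphisms. -/
theorem pullback_bijective {f : Λ →ₗ[ℤ] Λ'} (hf : IsLatticeIsogeny f) :
    Function.Bijective (pullback (V := V) S f) :=
  ⟨pullback_injective S hf, pullback_surjective S hf⟩

/-- **An isogeny induces an isomorphism on `H^1(·, V)`**: the `S`-linear equivalence
`Hom_ℤ(Λ', V) ≃ Hom_ℤ(Λ, V)`, `φ ↦ φ ∘ f`, for an isogeny of lattices `f : Λ → Λ'`. -/
noncomputable def pullbackEquiv {f : Λ →ₗ[ℤ] Λ'} (hf : IsLatticeIsogeny f) :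
    (Λ' →ₗ[ℤ] V) ≃ₗ[S] (Λ →ₗ[ℤ] V) :=
  LinearEquiv.ofBijective (pullback (V := V) S f) (pullback_bijective S hf)

/-- The equivalence acts by pre-composition with `f`. -/
@[simp] theorem pullbackEquiv_apply {f : Λ →ₗ[ℤ] Λ'} (hf : IsLatticeIsogeny f) (φ : Λ' →ₗ[ℤ] V) :
    pullbackEquiv (V := V) S hf φ = φ.comp f := rfl

/-- The inverse of the pull-back extends `ψ : Λ → V` to `Λ'`: `(pullbackEquiv⁻¹ ψ) ∘ f = ψ`. -/
theorem pullbackEquiv_symm_comp {f : Λ →ₗ[ℤ] Λ'} (hf : IsLatticeIsogeny f) (ψ : Λ →ₗ[ℤ] V) :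
    ((pullbackEquiv (V := V) S hf).symm ψ).comp f = ψ :=
  (pullbackEquiv (V := V) S hf).apply_symm_apply ψ

/-- Every homomorphism `Λ → V` extends uniquely along an isogeny `f : Λ → Λ'`. -/
theorem existsUnique_comp_eq {f : Λ →ₗ[ℤ] Λ'} (hf : IsLatticeIsogeny f) (ψ : Λ →ₗ[ℤ] V) :
    ∃! φ : Λ' →ₗ[ℤ] V, φ.comp f = ψ :=
  ⟨(pullbackEquiv (V := V) ℤ hf).symm ψ, pullbackEquiv_symm_comp ℤ hf ψ, fun φ hφ =>
    (pullbackEquiv (V := V) ℤ hf).eq_symm_apply.mpr (by simpa using hφ)⟩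

/-- Equivariance of the equivalence for compatible endomorphisms `a`, `a'` (`f ∘ a = a' ∘ f`). -/
theorem pullbackEquiv_actOn {f : Λ →ₗ[ℤ] Λ'} (hf : IsLatticeIsogeny f) {a : Λ →ₗ[ℤ] Λ}
    {a' : Λ' →ₗ[ℤ] Λ'} (hcomm : f.comp a = a'.comp f) (φ : Λ' →ₗ[ℤ] V) :
    pullbackEquiv (V := V) S hf (actOn S a' φ) = actOn S a (pullbackEquiv (V := V) S hf φ) :=
  pullback_actOn S hcomm φ

end RationalTarget

section Eigenspaces

variable {V : Type*} [AddCommGroup V] [Module ℚ V]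
variable (S : Type*) [CommRing S] [Module S V] [SMulCommClass ℤ S V]

/-- The pull-back along an isogeny maps the `μ`-eigenspace of `φ ↦ φ ∘ a'` onto the `μ`-eigenspace of
`φ ↦ φ ∘ a` whenever `f ∘ a = a' ∘ f` (the `τ`-eigenspaces of `H^1(A', ℂ)` and `H^1(A, ℂ)` for the
`F`-actions correspond under an `F`-equivariant isogeny). -/
theorem map_pullbackEquiv_eigenspace {f : Λ →ₗ[ℤ] Λ'} (hf : IsLatticeIsogeny f) {a : Λ →ₗ[ℤ] Λ}
    {a' : Λ' →ₗ[ℤ] Λ'} (hcomm : f.comp a = a'.comp f) (μ : S) :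
    Submodule.map (pullbackEquiv (V := V) S hf : (Λ' →ₗ[ℤ] V) →ₗ[S] (Λ →ₗ[ℤ] V))
        (Module.End.eigenspace (actOn (V := V) S a') μ) =
      Module.End.eigenspace (actOn (V := V) S a) μ := by
  ext ψ
  constructor
  · rintro ⟨φ, hφ, rfl⟩
    rw [SetLike.mem_coe, Module.End.mem_eigenspace_iff] at hφ
    rw [Module.End.mem_eigenspace_iff, LinearEquiv.coe_coe, ← pullbackEquiv_actOn S hf hcomm, hφ,
      map_smul]
  · intro hψ
    rw [Module.End.mem_eigenspace_iff] at hψ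
    refine ⟨(pullbackEquiv (V := V) S hf).symm ψ, ?_, by simp⟩
    rw [SetLike.mem_coe, Module.End.mem_eigenspace_iff]
    apply (pullbackEquiv (V := V) S hf).injective
    rw [pullbackEquiv_actOn S hf hcomm, LinearEquiv.apply_symm_apply, map_smul,
      LinearEquiv.apply_symm_apply, hψ]

end Eigenspaces

section RationalHomology

/-- Rational homology: `ℚ ⊗_ℤ f` is injective for an injective lattice map (`ℚ` is flat over `ℤ`). -/
theorem baseChange_injective {f : Λ →ₗ[ℤ] Λ'} (hf : Function.Injective f) :
    Function.Injective (f.baseChange ℚ) := by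
  rw [LinearMap.baseChange_eq_ltensor]
  exact Module.Flat.lTensor_preserves_injective_linearMap f hf

/-- Rational homology: `ℚ ⊗_ℤ f` is surjective for an isogeny (`q ⊗ x = (q/n) ⊗ (n • x)` and
`n • x` lies in the image). -/
theorem baseChange_surjective {f : Λ →ₗ[ℤ] Λ'} (hf : IsLatticeIsogeny f) :
    Function.Surjective (f.baseChange ℚ) := by
  obtain ⟨n, hn, hmem⟩ := hf.exists_nsmul_mem
  have hn' : (n : ℚ) ≠ 0 := by exact_mod_cast hn.ne'
  intro t
  induction t using TensorProduct.induction_on with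
  | zero => exact ⟨0, map_zero _⟩
  | tmul q x =>
    obtain ⟨y, hy⟩ := LinearMap.mem_range.mp (hmem x)
    refine ⟨((n : ℚ)⁻¹ * q) ⊗ₜ[ℤ] y, ?_⟩
    rw [LinearMap.baseChange_tmul, hy, ← natCast_zsmul, TensorProduct.tmul_smul,
      TensorProduct.smul_tmul', zsmul_eq_mul]
    congr 1
    push_cast
    field_simp
  | add t₁ t₂ h₁ h₂ =>
    obtain ⟨s₁, hs₁⟩ := h₁
    obtain ⟨s₂, hs₂⟩ := h₂
    exact ⟨s₁ + s₂, by rw [map_add, hs₁, hs₂]⟩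

/-- `ℚ ⊗_ℤ f` is bijective for an isogeny of lattices. -/
theorem baseChange_bijective {f : Λ →ₗ[ℤ] Λ'} (hf : IsLatticeIsogeny f) :
    Function.Bijective (f.baseChange ℚ) :=
  ⟨baseChange_injective hf.injective, baseChange_surjective hf⟩

/-- **An isogeny induces an isomorphism on rational homology**: `ℚ ⊗_ℤ Λ ≃ ℚ ⊗_ℤ Λ'` (`ℚ`-linear). -/
noncomputable def rationalHomologyEquiv {f : Λ →ₗ[ℤ] Λ'} (hf : IsLatticeIsogeny f) :
    TensorProduct ℤ ℚ Λ ≃ₗ[ℚ] TensorProduct ℤ ℚ Λ' :=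
  LinearEquiv.ofBijective (f.baseChange ℚ) (baseChange_bijective hf)

/-- The rational-homology equivalence on pure tensors: `q ⊗ x ↦ q ⊗ f x`. -/
@[simp] theorem rationalHomologyEquiv_tmul {f : Λ →ₗ[ℤ] Λ'} (hf : IsLatticeIsogeny f) (q : ℚ) (x : Λ) :
    rationalHomologyEquiv hf (q ⊗ₜ[ℤ] x) = q ⊗ₜ[ℤ] f x :=
  LinearMap.baseChange_tmul f q x

end RationalHomology

end Summit.Ventures.HodgeRepro2.IsogenyRational
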